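import Literature.MathematicalPhysics.QuantumFieldTheory.Balaban1983to89.B9RowSum261DefiniteFaces
import Literature.MathematicalPhysics.QuantumFieldTheory.Balaban1983to89.B9RWSums343to347Whole

/-!
# `Balaban1983to89.B9RWSums347DefiniteFaces` — [4] Lemma 2.1 SUPPLIED TO ROWS 13 ∕ 18 ∕ 19 OF THE N06 KNIT WITH DEFINITE DATA:
# the free-exponent door BY CHOICE (`exp261`), the member facts `Facts347` of the (3.47) passage from the record schemas
# `RowSum261` + `LevelGap`, and Theorem 3.7 ∕ Corollary 3.8 ∕ Theorem 3.10 as whole printed leaves at a LITERAL exponent —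
# at def-Y's members `geo9Y` with NO Lemma-2.1 binder

T. Bałaban, *Propagators for lattice gauge theories in a background field*, Commun. Math. Phys. **99** (1985) 389–434
[`Balaban1985BackgroundPropagators`, "B9"], Thm 3.7 (3.90) p. 409, Cor. 3.8 (3.94) p. 410, Thm 3.10 (3.107)–(3.108) pp. 415–416,
p. 398 *"It is easy to see that the global inequalities (3.47) are consequences of the local ones (3.42) and Lemma 2.1"*;
[4] = T. Bałaban, *Propagators and renormalization transformations for lattice gauge theories. II*, Commun. Math. Phys. **96**
(1984) 223–250 [`Balaban1984PropagatorsII`], Lemma 2.1 (2.59)–(2.61) pp. 233–234: *"e^{−αδ₀d(y,y′)} ≤ e^{−αδ₀RM max{|j−j′|−1,0}}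
(2.60) … sup_{y∈𝔅} Σ_{y′∈𝔅} e^{−αδ₀d(y,y′)} ≤ c₁(α), (2.61)"* for *"RM satisfying (2.59)"*.

statement-level skeleton of published theorems with citation tags; proofs where landed; nothing here is a claim about the
Yang–Mills mass gap

WHY THIS FILE (the rows-13∕18∕19 twin of n06-j's `B9RowSum261DefiniteFaces`, whose §3–§4 removed the (2.61) binder of rows
15–16 at the record).  The N06 knit at def-Y's instance (`Summits/…/BalabanUVNodesN06AtOpsYOfLettersAllPinsC`, rows 13, 18, 19)
still DISPLAYS [4] Lemma 2.1 about the GEOMETRY OF RECORD in six binders of printed shape — `h261 : ∀ x, M_L ≦ M →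
Ineq261 d (toB6 (geo9Y x) (R x) (H x)) δ₀ α` (the random-walk sums' (2.63) input, rows 13∕18), `hfacts : ∀ x, M_g ≦ M →
Facts347 (geo9Y x) (R x) (H x) d_F ((1 − 2α)δ₀) α_F L₀` and `hfacts₀ : … Facts347 … d_L δ₀ α L₀` (the (3.42) ⇒ (3.47) passage and
the scale transfers of the Hölder ∕ L² members, rows 18∕19), each twice (G′ and G side) — although n06-i PROVED (2.60)∕(2.61)
for `geo9Y` (`B9GeoLemma21KLevelV1.levelGap_geo9Y_one`, `rowSum261_geo9Y`).  Two obstacles kept them displayed: (a) the record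
schema `RowSum261` has a GENERIC, EXISTENTIAL constant per rate, while the faces read the printed `B6.c1 d δ₀ α` = 12c₀(½α)^d —
bridged by n06-j's free-exponent door (`B9RowSum261Faces.exists_le_c1`: c ≦ c₁ at SOME exponent d′), which yields `∃ d′` only;
(b) the exponent d′ enters the PINNED data (`const37 d′ …` in `(ops x).E37 = W38OfOps …` ∕ `(ops x).E310 = W310OfOps …`, and the
(3.47) constant `C·c₁(d_F)·L₀⁴ ≦ B₁`), so a literal pin cannot name `∃ d′`.  THIS FILE removes both: the door exponent is made
DEFINITE by choice, and every Lemma-2.1 datum of rows 13∕18∕19 is supplied at it.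

* §1 `exp261 geo δ₀ α : ℕ` — the door exponent BY CHOICE: an exponent d′ with `rowConst261 geo (αδ₀) ≦ c₁(d′, δ₀, α)`
  (`rowConst261_le_c1_exp261`); `ineq261_exp261_of_rowSum261` — `RowSum261 geo` ⇒ the PRINTED-SHAPE (2.61)
  `Ineq261 (exp261 geo δ₀ α) (toB6 (geo i) (R i) (H i)) δ₀ α` above one M-threshold (any transport letters `R`, `H`).
* §2 the member facts: `facts347_of_lemma21Above` (n06-j's `Lemma21Above` + 1 ≦ L_i ≦ L₀ + η_i > 0 ⇒ `Facts347`, repackaging);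
  `exists_facts347_of_rowSum261` (exponent existential); ★ `facts347_exp261_of_rowSum261` — from `0 < R₀`, `LevelGap geo R₀`,
  `RowSum261 geo`, `1 ≦ L_i ≦ L₀`, `η_i > 0`, for every 0 < α < 1, δ > 0: `Facts347 (geo i) R₀ (H i) (exp261 geo δ (1 − α)) δ α L₀`
  above one threshold ((2.60) by `ineq260_toB6_of_levelGap`, (2.61) at 1 − α by §1, the size condition 4·log L ≦ αδR₀M above
  4·log L₀∕(αδR₀)).
* §3 at def-Y's members (`geo9Y x = geo9K x.toKIdx`; R read as 1, L₀ = ℓ + 1): ★ `ineq261_exp261_geo9Y`, ★ `facts347_exp261_geo9Y`,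
  ★★ `lemma21Pack_geo9Y` — the THREE Lemma-2.1 binders of one side of rows 18∕19 (`h261` at (δ₀, α), `hfacts` at ((1 − 2α)δ₀, α_F),
  `hfacts₀` at (δ₀, α)) under ONE threshold, with ZERO hypotheses about the geometry (n06-i's `rowSum261_geo9Y`,
  `levelGap_geo9Y_one`, `distOK_geo9Y`, `B9Ineq347Reading.geo9Y_L` BY NAME); `geo9Y_dist_symm` for the leaves' `hdsymm`.
* §4 the sup-block leaves AT THE DEFINITE EXPONENT, fed by `RowSum261 geo` (every other binder VERBATIM as the landed faces
  `B9Thm37Whole.thm37Printed_of_local342`, `B9Cor38Whole.thm37Printed_W38OfOps_of_local342` ∕ `cor38Printed_of_local342`,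
  `B9Thm310Whole.thm310Printed_of_local3107`; n06-j's `B9RowSum261Faces` gave the `∃ d′` forms): ★ `thm37Printed_exp261_of_rowSum261`,
  ★ `thm37_cor38_W38OfOps_exp261_of_rowSum261`, ★ `thm310Printed_exp261_of_rowSum261` — so the knit's pins `E37OfOps ∕ W38OfOps ∕
  W310OfOps … (const37 (exp261 geo δ₀ α) …) ((1 − 2α)δ₀)` are LITERAL and carry NO (2.61) binder; at the record:
  `thm37_cor38_W38OfOps_exp261_geo9Y`, `thm310Printed_exp261_geo9Y`.

HONEST SCOPE.  One definition by choice + kernel bookkeeping over landed modules; nothing of [B9] or [4] is asserted: Corollary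
3.6 for the local operators (`Local342`, `Local342G`), the structure of the expansions (`Identities`, `Identities310`), (3.89)
(`Factors389`), the static data, sizes, readings and locality inputs remain HYPOTHESES of printed shape exactly as in the landed
faces; (2.60)∕(2.61) are consumed from the record schemas (theorems at `geo9Y`).  The constants `const37 (exp261 …) …`,
`c₁(exp261 …)` are α-dependent O(1)'s by choice, NOT print's c₁(α) (refuted as typed for d ≧ 3, `B6Lemma21Counterexample`).  NOT a
node discharge; count-neutral; one finite 𝕋⁴ programme at fixed ε — nothing continuum, nothing about the mass gap.  Cell `pub-ymgap`
(HUMAN RULING D-0062), Track A node N06 [B9], N06-ASSIGNMENT v1 bundle F6 (rows 18–19), seat `pub-ymgap-dag-n06-k` (gen 3), 2026-08-27.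
-/

noncomputable section

namespace Literature.MathematicalPhysics.QuantumFieldTheory.Balaban1983to89.B9RWSums347DefiniteFaces

open Literature.MathematicalPhysics.QuantumFieldTheory.Balaban1983to89
open Finset B6RandomWalk B9Thm34Ext B9Thm37Whole B9Cor38Whole B9Thm310Whole B9RowSum261Faces B9RowSum261DefiniteFaces
open B6Lemma21Repaired B9Ineq349Whole B9Ineq347Reading B9RWSums343to347Whole B9PinMembersKLevelV1 B9GeoLemma21KLevelV1

/-! ## §1 The free-exponent door BY CHOICE -/

section Exp

variable {I : Type} (geo : I → B9.Geometry) [∀ i, Fintype (geo i).Site]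

open Classical in
/-- **THE (2.61) DOOR EXPONENT OF THE FAMILY AT THE RATE PAIR (δ₀, α), BY CHOICE** — p. 234 *"sup_{y∈𝔅} Σ_{y′∈𝔅} e^{−αδ₀d(y,y′)} ≤
c₁(α), (2.61)"*, c₁(α) = 12c₀(½α)^d: an exponent d′ with `rowConst261 geo (αδ₀) ≦ 12·c₀(δ₀, ½α)^{d′}` (there is one when αδ₀ > 0
since c₀ > 1, `B9RowSum261Faces.exists_le_c1`); 0 when αδ₀ ≦ 0.  OURS (a definite name, so that a consumer can PIN data
`const37 d′ …` literally); print's d (the dimension) is NOT asserted to be one. [cite: Balaban1984PropagatorsII, Lemma 2.1 (2.61) p.234] -/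
def exp261 (δ₀ α : ℝ) : ℕ :=
  if h : 0 < α * δ₀ then Classical.choose (exists_le_c1 (rowConst261 geo (α * δ₀)) h) else 0

/-- **The defining property**: for αδ₀ > 0 the family's definite (2.61) constant at rate αδ₀ is below the printed-shape constant
at the door exponent, `rowConst261 geo (αδ₀) ≦ c₁(exp261 geo δ₀ α, δ₀, α)`. [cite: Balaban1984PropagatorsII, Lemma 2.1 (2.61) p.234] -/
theorem rowConst261_le_c1_exp261 {δ₀ α : ℝ} (h : 0 < α * δ₀) :
    rowConst261 geo (α * δ₀) ≤ B6.c1 (exp261 geo δ₀ α) δ₀ α := by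
  unfold exp261
  rw [dif_pos h]
  exact Classical.choose_spec (exists_le_c1 (rowConst261 geo (α * δ₀)) h)

variable {geo}

/-- ★ **`RowSum261` THROUGH THE DOOR AT THE DEFINITE EXPONENT**: the record schema (2.61)-at-every-rate-with-a-generic-constant
(`B9Ineq349Whole.RowSum261 geo`, *"for RM satisfying (2.59)"* = the M-threshold) gives, at the rate αδ₀ > 0, the PRINTED-SHAPE
(2.61) `B6RandomWalk.Ineq261 (exp261 geo δ₀ α) (toB6 (geo i) (R i) (H i)) δ₀ α` for every member above one threshold, for ANY
transport letters `R`, `H` (the row sums read only 𝔅 and d). [cite: Balaban1984PropagatorsII, Lemma 2.1 (2.61) p.234 + (2.59) p.233] -/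
theorem ineq261_exp261_of_rowSum261 (R : I → ℝ) (H : I → Prop) {δ₀ α : ℝ} (hκ : 0 < α * δ₀)
    (hrow : RowSum261 geo) :
    ∃ ML : ℝ, ∀ i, ML ≤ (geo i).M → Ineq261 (exp261 geo δ₀ α) (toB6 (geo i) (R i) (H i)) δ₀ α := by
  obtain ⟨ML, h⟩ := ineq261With_rowConst261_of_rowSum261 R H hκ hrow
  exact ⟨ML, fun i hi => B6RandomWalkHom.ineq261_of_rowSum_le (g := toB6 (geo i) (R i) (H i)) _ δ₀ α _ (h i hi)
    (rowConst261_le_c1_exp261 geo hκ)⟩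

/-- Two rates at once under ONE threshold (e.g. the walk input at (δ₀, α) and a second one at (δ₁, α₁)).
[cite: Balaban1984PropagatorsII, Lemma 2.1 (2.61) p.234 + (2.59) p.233] -/
theorem ineq261_exp261_pair_of_rowSum261 (R : I → ℝ) (H : I → Prop) {δ₀ α δ₁ α₁ : ℝ} (hκ : 0 < α * δ₀)
    (hκ₁ : 0 < α₁ * δ₁) (hrow : RowSum261 geo) :
    ∃ ML : ℝ, ∀ i, ML ≤ (geo i).M →
      Ineq261 (exp261 geo δ₀ α) (toB6 (geo i) (R i) (H i)) δ₀ α ∧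
        Ineq261 (exp261 geo δ₁ α₁) (toB6 (geo i) (R i) (H i)) δ₁ α₁ := by
  obtain ⟨ML₀, h₀⟩ := ineq261_exp261_of_rowSum261 R H hκ hrow
  obtain ⟨ML₁, h₁⟩ := ineq261_exp261_of_rowSum261 R H hκ₁ hrow
  exact ⟨max ML₀ ML₁, fun i hi => ⟨h₀ i ((le_max_left _ _).trans hi), h₁ i ((le_max_right _ _).trans hi)⟩⟩

end Exp

/-! ## §2 The member facts `Facts347` of the (3.42) ⇒ (3.47) passage from the record schemas -/

section Facts

variable {I : Type} {geo : I → B9.Geometry} [∀ i, Fintype (geo i).Site]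

/-- **`Facts347` FROM n06-j's `Lemma21Above`** (repackaging): Lemma 2.1 above a threshold with R read as R₀ ((2.60) at α, (2.61) at
1 − α, the size condition 4·log L ≦ αδR₀M), together with 1 ≦ L_i ≦ L₀ and η_i > 0, IS the member-facts schema of the (3.47)
passage above that threshold. [cite: Balaban1985BackgroundPropagators, p.398 remark after (3.47); Balaban1984PropagatorsII, Lemma 2.1 (2.59)–(2.61) pp.233–234] -/
theorem facts347_of_lemma21Above {d : ℕ} {R₀ δ α ML L₀ : ℝ} {H : I → Prop}
    (h21 : Lemma21Above d geo (fun _ => R₀) H δ α ML) (hL1 : ∀ i, 1 ≤ (geo i).L) (hLle : ∀ i, (geo i).L ≤ L₀)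
    (hη : ∀ i, 0 < (geo i).eta) :
    ∀ i, ML ≤ (geo i).M → Facts347 (geo i) R₀ (H i) d δ α L₀ := by
  intro i hi
  obtain ⟨h260, h261, hsize⟩ := h21 i hi
  exact { one_le_L := hL1 i, L_le := hLle i, eta_pos := hη i, h260 := h260, h261 := h261, size := hsize }

/-- **`Facts347` FROM THE RECORD SCHEMAS, THE EXPONENT EXISTENTIAL**: from the level gap at R₀ > 0, `RowSum261 geo`, 1 ≦ L_i ≦ L₀
and η_i > 0, for every 0 < α < 1 and δ > 0 there are an exponent d and a threshold M_g with `Facts347 (geo i) R₀ (H i) d δ α L₀`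
for every member above M_g (n06-j's `exists_lemma21Above_of_rowSum261`, repackaged). [cite: Balaban1985BackgroundPropagators, p.398 remark after (3.47); Balaban1984PropagatorsII, Lemma 2.1 (2.59)–(2.61) pp.233–234] -/
theorem exists_facts347_of_rowSum261 {R₀ : ℝ} (hR₀ : 0 < R₀) (hgap : LevelGap geo R₀) (hrow : RowSum261 geo)
    {L₀ : ℝ} (hL1 : ∀ i, 1 ≤ (geo i).L) (hLle : ∀ i, (geo i).L ≤ L₀) (hη : ∀ i, 0 < (geo i).eta) (H : I → Prop)
    {α : ℝ} (hα0 : 0 < α) (hα1 : α < 1) {δ : ℝ} (hδ : 0 < δ) :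
    ∃ (d : ℕ) (Mg : ℝ), ∀ i, Mg ≤ (geo i).M → Facts347 (geo i) R₀ (H i) d δ α L₀ := by
  obtain ⟨d, ML, h21⟩ := exists_lemma21Above_of_rowSum261 hR₀ hgap hrow hL1 hLle H hα0 hα1 hδ
  exact ⟨d, ML, facts347_of_lemma21Above h21 hL1 hLle hη⟩

/-- ★ **`Facts347` FROM THE RECORD SCHEMAS AT THE DEFINITE EXPONENT `exp261 geo δ (1 − α)`** — p. 398 *"the global inequalities
(3.47) are consequences of the local ones (3.42) and Lemma 2.1"*, Lemma 2.1 *"for RM satisfying (2.59)"* absorbed in the threshold: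
from `0 < R₀`, `LevelGap geo R₀`, `RowSum261 geo`, `1 ≦ L_i ≦ L₀`, `η_i > 0`, for every 0 < α < 1 and δ > 0 there is M_g with
`Facts347 (geo i) R₀ (H i) (exp261 geo δ (1 − α)) δ α L₀` for every member above M_g: (2.60) at α from the level gap
(`ineq260_toB6_of_levelGap`), (2.61) at 1 − α at the door exponent (§1), the size condition above 4·log L₀∕(αδR₀).
[cite: Balaban1985BackgroundPropagators, p.398 remark after (3.47); Balaban1984PropagatorsII, Lemma 2.1 (2.59)–(2.61) pp.233–234] -/
theorem facts347_exp261_of_rowSum261 {R₀ : ℝ} (hR₀ : 0 < R₀) (hgap : LevelGap geo R₀) (hrow : RowSum261 geo)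
    {L₀ : ℝ} (hL1 : ∀ i, 1 ≤ (geo i).L) (hLle : ∀ i, (geo i).L ≤ L₀) (hη : ∀ i, 0 < (geo i).eta) (H : I → Prop)
    {α : ℝ} (hα0 : 0 < α) (hα1 : α < 1) {δ : ℝ} (hδ : 0 < δ) :
    ∃ Mg : ℝ, ∀ i, Mg ≤ (geo i).M → Facts347 (geo i) R₀ (H i) (exp261 geo δ (1 - α)) δ α L₀ := by
  have hκ : 0 < (1 - α) * δ := mul_pos (by linarith) hδ
  obtain ⟨ML, h261⟩ := ineq261_exp261_of_rowSum261 (geo := geo) (fun _ => R₀) H hκ hrow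
  have hc : 0 < α * δ * R₀ := mul_pos (mul_pos hα0 hδ) hR₀
  refine ⟨max ML (4 * Real.log L₀ / (α * δ * R₀)), fun i hi => ?_⟩
  have hM : 4 * Real.log L₀ / (α * δ * R₀) ≤ (geo i).M := (le_max_right _ _).trans hi
  have hlog : Real.log (geo i).L ≤ Real.log L₀ := Real.log_le_log (lt_of_lt_of_le one_pos (hL1 i)) (hLle i)
  have h2 : 4 * Real.log L₀ ≤ (geo i).M * (α * δ * R₀) := (div_le_iff₀ hc).mp hM
  exact { one_le_L := hL1 i, L_le := hLle i, eta_pos := hη i,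
          h260 := ineq260_toB6_of_levelGap hgap (mul_pos hα0 hδ).le (H i) i,
          h261 := h261 i ((le_max_left _ _).trans hi),
          size := by nlinarith }

/-- ★ **ONE SIDE OF ROWS 18∕19, ALL THREE LEMMA-2.1 BINDERS UNDER ONE THRESHOLD, from the record schemas** (the shapes the knit
displays for the sum G′(U) resp. G(U): `h261` at (δ₀, α) — the walks' (2.61) input; `hfacts` at ((1 − 2α)δ₀, α_F) — the (3.47)
passage at the sum's rate; `hfacts₀` at (δ₀, α) — the scale transfers of the Hölder ∕ L² members at Cor. 3.6's rate), R read as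
R₀, exponents `exp261 geo δ₀ α`, `exp261 geo ((1 − 2α)δ₀) (1 − α_F)`, `exp261 geo δ₀ (1 − α)`.  Needs 0 < α < ½, δ₀ > 0, 0 < α_F < 1.
[cite: Balaban1985BackgroundPropagators, Thm 3.7 p.409 + Thm 3.10 p.416 + p.398 remark after (3.47); Balaban1984PropagatorsII, Lemma 2.1 (2.59)–(2.61) pp.233–234] -/
theorem lemma21Pack_of_rowSum261 {R₀ : ℝ} (hR₀ : 0 < R₀) (hgap : LevelGap geo R₀) (hrow : RowSum261 geo)
    {L₀ : ℝ} (hL1 : ∀ i, 1 ≤ (geo i).L) (hLle : ∀ i, (geo i).L ≤ L₀) (hη : ∀ i, 0 < (geo i).eta) (H : I → Prop)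
    {α δ₀ αF : ℝ} (hα : 0 < α) (hα2 : α < 1 / 2) (hδ₀ : 0 < δ₀) (hαF : 0 < αF) (hαF1 : αF < 1) :
    ∃ Mth : ℝ,
      (∀ i, Mth ≤ (geo i).M → Ineq261 (exp261 geo δ₀ α) (toB6 (geo i) R₀ (H i)) δ₀ α) ∧
      (∀ i, Mth ≤ (geo i).M →
        Facts347 (geo i) R₀ (H i) (exp261 geo ((1 - 2 * α) * δ₀) (1 - αF)) ((1 - 2 * α) * δ₀) αF L₀) ∧
      (∀ i, Mth ≤ (geo i).M → Facts347 (geo i) R₀ (H i) (exp261 geo δ₀ (1 - α)) δ₀ α L₀) := by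
  have hδ : 0 < (1 - 2 * α) * δ₀ := mul_pos (by linarith) hδ₀
  obtain ⟨ML, h261⟩ := ineq261_exp261_of_rowSum261 (geo := geo) (fun _ => R₀) H (mul_pos hα hδ₀) hrow
  obtain ⟨Mg, hF⟩ := facts347_exp261_of_rowSum261 hR₀ hgap hrow hL1 hLle hη H hαF hαF1 hδ
  obtain ⟨MF, hF₀⟩ := facts347_exp261_of_rowSum261 hR₀ hgap hrow hL1 hLle hη H hα (by linarith) hδ₀
  exact ⟨max ML (max Mg MF), fun i hi => h261 i ((le_max_left _ _).trans hi),
    fun i hi => hF i (((le_max_left _ _).trans (le_max_right _ _)).trans hi),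
    fun i hi => hF₀ i (((le_max_right _ _).trans (le_max_right _ _)).trans hi)⟩

end Facts

/-! ## §3 At def-Y's members `geo9Y x`: the Lemma-2.1 data of rows 13∕18∕19 with NO hypothesis about the geometry -/

section StageY

variable {d ℓ : ℕ} {hd : 1 ≤ d + 1} {hL : Odd (ℓ + 1) ∧ 1 < ℓ + 1} {b₀ b₁ : ℝ} {Mstar : ℕ}

/-- `d(a, b) = d(b, a)` at a member (the leaves' binder `hdsymm`; n06-i's `geo9Y_dist_comm`).
[cite: Balaban1984PropagatorsII, (2.46) p.231, bookkeeping] -/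
theorem geo9Y_dist_symm : ∀ (x : MemberY d ℓ hd hL b₀ b₁ Mstar) (a b : (geo9Y x).Site), (geo9Y x).dist a b = (geo9Y x).dist b a :=
  fun x a b => geo9Y_dist_comm x a b

/-- `1 ≤ L`, `L ≤ ℓ + 1`, `0 < η` at every member (the three scalar facts `Facts347` asks of the geometry).
[cite: Balaban1985BackgroundPropagators, (3.41) p.397 («Lʲη»), bookkeeping] -/
theorem geo9Y_scalars (x : MemberY d ℓ hd hL b₀ b₁ Mstar) :
    1 ≤ (geo9Y x).L ∧ (geo9Y x).L ≤ ((ℓ + 1 : ℕ) : ℝ) ∧ 0 < (geo9Y x).eta :=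
  ⟨(distOK_geo9Y x).one_le_L, (geo9Y_L x).le, (distOK_geo9Y x).eta_pos⟩

variable [∀ x : MemberY d ℓ hd hL b₀ b₁ Mstar, Fintype (geo9Y x).Site]

/-- ★ **[4] (2.61) IN PRINTED SHAPE AT THE GEOMETRY OF RECORD, AT THE DEFINITE EXPONENT, BY NAME**: for αδ₀ > 0 there is M_L with
`Ineq261 (exp261 geo9Y δ₀ α) (toB6 (geo9Y x) (R x) (H x)) δ₀ α` for every member above M_L — n06-i's `rowSum261_geo9Y` through the
door; any transport letters. [cite: Balaban1984PropagatorsII, Lemma 2.1 (2.61) p.234 + (2.59) p.233] -/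
theorem ineq261_exp261_geo9Y (R : MemberY d ℓ hd hL b₀ b₁ Mstar → ℝ) (H : MemberY d ℓ hd hL b₀ b₁ Mstar → Prop)
    {δ₀ α : ℝ} (hκ : 0 < α * δ₀) :
    ∃ ML : ℝ, ∀ x, ML ≤ (geo9Y x).M →
      Ineq261 (exp261 (@geo9Y d ℓ hd hL b₀ b₁ Mstar) δ₀ α) (toB6 (geo9Y x) (R x) (H x)) δ₀ α :=
  ineq261_exp261_of_rowSum261 R H hκ rowSum261_geo9Y

/-- ★ **THE MEMBER FACTS OF THE (3.47) PASSAGE AT THE GEOMETRY OF RECORD, BY NAME** (R read as 1, L₀ = ℓ + 1): for every 0 < α < 1,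
δ > 0 there is M_g with `Facts347 (geo9Y x) 1 (H x) (exp261 geo9Y δ (1 − α)) δ α (ℓ + 1)` for every member above M_g — from n06-i's
`levelGap_geo9Y_one`, `rowSum261_geo9Y`, `distOK_geo9Y` and `geo9Y_L`. [cite: Balaban1985BackgroundPropagators, p.398 remark after (3.47); Balaban1984PropagatorsII, Lemma 2.1 (2.59)–(2.61) pp.233–234] -/
theorem facts347_exp261_geo9Y (H : MemberY d ℓ hd hL b₀ b₁ Mstar → Prop) {α : ℝ} (hα0 : 0 < α) (hα1 : α < 1)
    {δ : ℝ} (hδ : 0 < δ) :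
    ∃ Mg : ℝ, ∀ x, Mg ≤ (geo9Y x).M →
      Facts347 (geo9Y x) 1 (H x) (exp261 (@geo9Y d ℓ hd hL b₀ b₁ Mstar) δ (1 - α)) δ α ((ℓ + 1 : ℕ) : ℝ) :=
  facts347_exp261_of_rowSum261 one_pos levelGap_geo9Y_one rowSum261_geo9Y (fun x => (geo9Y_scalars x).1)
    (fun x => (geo9Y_scalars x).2.1) (fun x => (geo9Y_scalars x).2.2) H hα0 hα1 hδ

/-- ★★ **ONE SIDE OF ROWS 18∕19 AT THE RECORD: ALL THREE LEMMA-2.1 BINDERS, ZERO HYPOTHESES ABOUT THE GEOMETRY** — the knit's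
`h261` (rate (δ₀, α)), `hfacts` (rate ((1 − 2α)δ₀, α_F)), `hfacts₀` (rate (δ₀, α)) for the sum G′(U) (Theorem 3.7) resp. G(U)
(Theorem 3.10) under one threshold, R read as 1, L₀ = ℓ + 1, exponents `exp261 geo9Y δ₀ α`, `exp261 geo9Y ((1 − 2α)δ₀) (1 − α_F)`,
`exp261 geo9Y δ₀ (1 − α)`; needs 0 < α < ½, δ₀ > 0, 0 < α_F < 1. [cite: Balaban1985BackgroundPropagators, Thm 3.7 p.409 + Thm 3.10 p.416 + p.398 remark after (3.47); Balaban1984PropagatorsII, Lemma 2.1 (2.59)–(2.61) pp.233–234] -/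
theorem lemma21Pack_geo9Y (H : MemberY d ℓ hd hL b₀ b₁ Mstar → Prop) {α δ₀ αF : ℝ} (hα : 0 < α) (hα2 : α < 1 / 2)
    (hδ₀ : 0 < δ₀) (hαF : 0 < αF) (hαF1 : αF < 1) :
    ∃ Mth : ℝ,
      (∀ x, Mth ≤ (geo9Y x).M → Ineq261 (exp261 (@geo9Y d ℓ hd hL b₀ b₁ Mstar) δ₀ α) (toB6 (geo9Y x) 1 (H x)) δ₀ α) ∧
      (∀ x, Mth ≤ (geo9Y x).M →
        Facts347 (geo9Y x) 1 (H x) (exp261 (@geo9Y d ℓ hd hL b₀ b₁ Mstar) ((1 - 2 * α) * δ₀) (1 - αF))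
          ((1 - 2 * α) * δ₀) αF ((ℓ + 1 : ℕ) : ℝ)) ∧
      (∀ x, Mth ≤ (geo9Y x).M →
        Facts347 (geo9Y x) 1 (H x) (exp261 (@geo9Y d ℓ hd hL b₀ b₁ Mstar) δ₀ (1 - α)) δ₀ α ((ℓ + 1 : ℕ) : ℝ)) :=
  lemma21Pack_of_rowSum261 one_pos levelGap_geo9Y_one rowSum261_geo9Y (fun x => (geo9Y_scalars x).1)
    (fun x => (geo9Y_scalars x).2.1) (fun x => (geo9Y_scalars x).2.2) H hα hα2 hδ₀ hαF hαF1

end StageY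

/-! ## §4 Theorem 3.7 ∕ Corollary 3.8 ∕ Theorem 3.10 as whole printed leaves AT THE DEFINITE EXPONENT, fed by `RowSum261` -/

section Faces

variable {I : Type} {c35 : ℝ} {geo : I → B9.Geometry} {bg : I → B9.Backgrounds}
variable [∀ i, Fintype (geo i).Site] [∀ i, DecidableEq (geo i).Site]
variable {X Y ι A : I → Type} [∀ i, Fintype (X i)] [∀ i, DecidableEq (X i)] [∀ i, Fintype (Y i)]
  [∀ i, DecidableEq (Y i)] [∀ i, Fintype (ι i)]

/-- ★ **THEOREM 3.7 AS THE WHOLE PRINTED LEAF AT THE DEFINITE EXPONENT, (2.61) SUPPLIED BY `RowSum261`** (p. 409: *"For M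
sufficiently large, and a configuration U satisfying (3.35), the operator G′ can be represented as … (3.90) … convergent in all norms
appearing in the inequalities (3.42)–(3.47)."*): n06-c's `B9Thm37Whole.thm37Printed_of_local342` with its (2.61) input taken through
the door at `exp261 geo δ₀ α` — `B9.Thm37Printed c35 geo bg (fun i => E37OfOps (𝔴 i) (𝔬 i) (R i) (H i) (const37 (exp261 geo δ₀ α) δ₀
α ρ B₀ N N′ C_ℓ K) ((1 − 2α)δ₀))`, a LITERAL datum.  Needs 0 < α ≦ ½, 0 < δ₀; every other input VERBATIM.
[cite: Balaban1985BackgroundPropagators, Thm 3.7 (3.90) pp.409–410 + Cor. 3.6 p.408 + (3.35) p.396; Balaban1984PropagatorsII, Lemma 2.1 (2.61) p.234] -/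
theorem thm37Printed_exp261_of_rowSum261 (𝔴 : ∀ i, B9.RWExpansion (geo i) (bg i))
    (𝔬 : ∀ i, Ops (geo i) (bg i) (X i) (Y i) (ι i)) (R : I → ℝ) (H : I → Prop) (κ : I → Sizes)
    (α ρ N N' Cℓ K θ₀ B₀ δ₀ a₁ M₁ : ℝ)
    (hc : 0 < c35) (hα : 0 < α) (hα2 : α ≤ 1 / 2) (hN : 0 ≤ N) (hN' : 0 ≤ N') (hCℓ : 1 ≤ Cℓ) (hK : 0 ≤ K)
    (hB₀ : 0 ≤ B₀) (hδ₀ : 0 < δ₀) (ha₁ : 0 < a₁) (hM₁ : 0 < M₁)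
    (hst : ∀ i, StaticOK (𝔬 i) ρ N N' Cℓ (κ i)) (hκ : ∀ i, (κ i).Bounded K θ₀ Cℓ (geo i).M)
    (hrow : RowSum261 geo)
    (h36 : ∀ i, M₁ ≤ (geo i).M → ∀ α₀ : ℝ, 0 < α₀ → c35 * (geo i).M * α₀ ≤ a₁ →
      ∀ U : (bg i).Cfg, (bg i).Reg335 c35 α₀ U →
        Local342 (𝔬 i) (R i) (H i) B₀ δ₀ U ∧ Identities (𝔬 i) (R i) (H i) U) :
    B9.Thm37Printed c35 geo bg
      (fun i => E37OfOps (𝔴 i) (𝔬 i) (R i) (H i) (const37 (exp261 geo δ₀ α) δ₀ α ρ B₀ N N' Cℓ K)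
        ((1 - 2 * α) * δ₀)) := by
  obtain ⟨ML, h261⟩ := ineq261_exp261_of_rowSum261 (geo := geo) R H (mul_pos hα hδ₀) hrow
  exact thm37Printed_of_local342 𝔴 𝔬 R H κ _ α ρ N N' Cℓ K θ₀ B₀ δ₀ a₁ M₁ ML hc hα.le hα2 hN hN' hCℓ hK hB₀
    hδ₀.le ha₁ hM₁ hst hκ h261 h36

/-- ★ **ROWS t37 AND c38 AT ONE LITERAL DATUM, (2.61) SUPPLIED BY `RowSum261`**: Theorem 3.7 and Corollary 3.8 as the whole printed
leaves at the SAME pinned datum `W38OfOps (𝔬 i) (rd i) (R i) (H i) (const37 (exp261 geo δ₀ α) …) ((1 − 2α)δ₀)`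
(`B9Cor38Whole.thm37Printed_W38OfOps_of_local342` + `cor38Printed_of_local342`) — the knit's walk pin `(ops x).E37 = W38OfOps …`
names the exponent and carries no (2.61) binder. [cite: Balaban1985BackgroundPropagators, Thm 3.7 (3.90) pp.409–410 + Cor. 3.8 (3.94) p.410; Balaban1984PropagatorsII, Lemma 2.1 (2.61) p.234] -/
theorem thm37_cor38_W38OfOps_exp261_of_rowSum261 (𝔬 : ∀ i, Ops (geo i) (bg i) (X i) (Y i) (ι i))
    (rd : ∀ i, WalkReading (geo i) (bg i) (X i) (ι i)) (R : I → ℝ) (H : I → Prop) (κ : I → Sizes)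
    (α ρ N N' Cℓ K θ₀ B₀ δ₀ a₁ M₁ : ℝ)
    (hc : 0 < c35) (hα : 0 < α) (hα2 : α ≤ 1 / 2) (hN : 0 ≤ N) (hN' : 0 ≤ N') (hCℓ : 1 ≤ Cℓ) (hK : 0 ≤ K)
    (hθ₀ : 0 ≤ θ₀) (hB₀ : 0 < B₀) (hδ₀ : 0 < δ₀) (ha₁ : 0 < a₁) (hM₁ : 0 < M₁)
    (hst : ∀ i, StaticOK (𝔬 i) ρ N N' Cℓ (κ i)) (hκ : ∀ i, (κ i).Bounded K θ₀ Cℓ (geo i).M)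
    (hrd : ∀ i, (rd i).OK (𝔬 i).blk) (hloc : ∀ i, Locality (𝔬 i) (rd i))
    (hrow : RowSum261 geo)
    (h36 : ∀ i, M₁ ≤ (geo i).M → ∀ α₀ : ℝ, 0 < α₀ → c35 * (geo i).M * α₀ ≤ a₁ →
      ∀ U : (bg i).Cfg, (bg i).Reg335 c35 α₀ U →
        Local342 (𝔬 i) (R i) (H i) B₀ δ₀ U ∧ Identities (𝔬 i) (R i) (H i) U) :
    B9.Thm37Printed c35 geo bg
        (fun i => W38OfOps (𝔬 i) (rd i) (R i) (H i) (const37 (exp261 geo δ₀ α) δ₀ α ρ B₀ N N' Cℓ K)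
          ((1 - 2 * α) * δ₀)) ∧
      B9.Cor38Printed c35 geo bg
        (fun i => W38OfOps (𝔬 i) (rd i) (R i) (H i) (const37 (exp261 geo δ₀ α) δ₀ α ρ B₀ N N' Cℓ K)
          ((1 - 2 * α) * δ₀)) := by
  obtain ⟨ML, h261⟩ := ineq261_exp261_of_rowSum261 (geo := geo) R H (mul_pos hα hδ₀) hrow
  exact ⟨thm37Printed_W38OfOps_of_local342 𝔬 rd R H κ _ α ρ N N' Cℓ K θ₀ B₀ δ₀ a₁ M₁ ML hc hα.le hα2 hN hN' hCℓ
      hK hB₀.le hδ₀.le ha₁ hM₁ hst hκ h261 h36,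
    cor38Printed_of_local342 𝔬 rd R H κ _ _ _ α ρ N N' Cℓ K θ₀ B₀ δ₀ a₁ M₁ ML hc hα.le (by linarith) hθ₀ hB₀ hδ₀
      ha₁ hM₁ hst hκ hrd hloc h261 h36⟩

variable [∀ i, Fintype (A i)]

/-- ★ **THEOREM 3.10 AS THE WHOLE PRINTED LEAF AT THE DEFINITE EXPONENT, (2.61) SUPPLIED BY `RowSum261`** (pp. 415–416: *"For M
sufficiently large, and a configuration U satisfying (3.35), the operator G has the expansion G = Σ_ω R₀(X₀)R_{α₁}(X₁)·⋯·R_{αₙ}(Xₙ),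
(3.107) …"*): this seat's `B9Thm310Whole.thm310Printed_of_local3107` through the door at `exp261 geo δ₀ α` — `B9.Thm310Printed c35
geo bg (fun i => W310OfOps (𝔬 i) (rd i) (Conv3107 (𝔬 i) (R i) (H i) (const37 (exp261 geo δ₀ α) δ₀ α ρ B₀ N N′ C_ℓ K) ((1 − 2α)δ₀)))`,
a LITERAL datum.  Needs 0 < α ≦ ½, 0 < δ₀; every other input VERBATIM. [cite: Balaban1985BackgroundPropagators, Thm 3.10 (3.107)–(3.108) pp.415–416 + (3.35) p.396; Balaban1984PropagatorsII, Lemma 2.1 (2.61) p.234] -/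
theorem thm310Printed_exp261_of_rowSum261 (𝔬 : ∀ i, Ops310 (geo i) (bg i) (X i) (Y i) (ι i) (A i))
    (rd : ∀ i, WalkReading310 (geo i) (bg i) (X i) (ι i) (A i)) (R : I → ℝ) (H : I → Prop)
    (κ : I → Sizes310) (α ρ N N' NF Cℓ K θ₀ B₀ δ₀ a₁ M₁ : ℝ)
    (hc : 0 < c35) (hα : 0 < α) (hα2 : α ≤ 1 / 2) (hN : 0 ≤ N) (hN' : 0 ≤ N') (hNF : 0 ≤ NF) (hCℓ : 1 ≤ Cℓ)
    (hK : 0 ≤ K) (hθ₀ : 0 ≤ θ₀) (hB₀ : 0 < B₀) (hδ₀ : 0 < δ₀) (ha₁ : 0 < a₁) (hM₁ : 0 < M₁)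
    (hst : ∀ i, StaticOK310 (𝔬 i) ρ N N' NF Cℓ (κ i)) (hκ : ∀ i, (κ i).Bounded K)
    (hrd : ∀ i, (rd i).OK (𝔬 i).blk) (hloc : ∀ i, Locality310 (𝔬 i) (rd i))
    (hrow : RowSum261 geo)
    (h36 : ∀ i, M₁ ≤ (geo i).M → ∀ α₀ : ℝ, 0 < α₀ → c35 * (geo i).M * α₀ ≤ a₁ →
      ∀ U : (bg i).Cfg, (bg i).Reg335 c35 α₀ U →
        Local342G (𝔬 i) (R i) (H i) B₀ δ₀ U ∧ B9Thm310Whole.Factors389 (𝔬 i) (R i) (H i) θ₀ δ₀ U ∧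
          Identities310 (𝔬 i) (R i) (H i) U) :
    B9.Thm310Printed c35 geo bg
      (fun i => W310OfOps (𝔬 i) (rd i)
        (Conv3107 (𝔬 i) (R i) (H i) (const37 (exp261 geo δ₀ α) δ₀ α ρ B₀ N N' Cℓ K) ((1 - 2 * α) * δ₀))) := by
  obtain ⟨ML, h261⟩ := ineq261_exp261_of_rowSum261 (geo := geo) R H (mul_pos hα hδ₀) hrow
  exact thm310Printed_of_local3107 𝔬 rd R H κ _ α ρ N N' NF Cℓ K θ₀ B₀ δ₀ a₁ M₁ ML hc hα.le hα2 hN hN' hNF hCℓ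
    hK hθ₀ hB₀ hδ₀ ha₁ hM₁ hst hκ hrd hloc h261 h36

end Faces

/-! ## §5 The sup-block leaves of rows 13 ∕ 18 at def-Y's members, LITERAL exponent, NO (2.61) binder -/

section FacesY

variable {d ℓ : ℕ} {hd : 1 ≤ d + 1} {hL : Odd (ℓ + 1) ∧ 1 < ℓ + 1} {b₀ b₁ : ℝ} {Mstar : ℕ}
variable [∀ x : MemberY d ℓ hd hL b₀ b₁ Mstar, Fintype (geo9Y x).Site]
  [∀ x : MemberY d ℓ hd hL b₀ b₁ Mstar, DecidableEq (geo9Y x).Site]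
variable {c35 : ℝ} {bg : MemberY d ℓ hd hL b₀ b₁ Mstar → B9.Backgrounds}
variable {X Y ι A : MemberY d ℓ hd hL b₀ b₁ Mstar → Type} [∀ x, Fintype (X x)] [∀ x, DecidableEq (X x)]
  [∀ x, Fintype (Y x)] [∀ x, DecidableEq (Y x)] [∀ x, Fintype (ι x)]

/-- ★ **ROW 13 (t37 ∧ c38) AT THE RECORD GEOMETRY WITH NO (2.61) BINDER**: Theorem 3.7 and Corollary 3.8 as the whole printed leaves
at the literal datum `W38OfOps (𝔬 x) (rd x) (R x) (H x) (const37 (exp261 geo9Y δ₀ α) …) ((1 − 2α)δ₀)` over def-Y's members — (2.61)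
from n06-i's `rowSum261_geo9Y` BY NAME. [cite: Balaban1985BackgroundPropagators, Thm 3.7 (3.90) pp.409–410 + Cor. 3.8 (3.94) p.410; Balaban1984PropagatorsII, Lemma 2.1 (2.61) p.234] -/
theorem thm37_cor38_W38OfOps_exp261_geo9Y
    (𝔬 : ∀ x : MemberY d ℓ hd hL b₀ b₁ Mstar, Ops (geo9Y x) (bg x) (X x) (Y x) (ι x))
    (rd : ∀ x : MemberY d ℓ hd hL b₀ b₁ Mstar, WalkReading (geo9Y x) (bg x) (X x) (ι x))
    (R : MemberY d ℓ hd hL b₀ b₁ Mstar → ℝ) (H : MemberY d ℓ hd hL b₀ b₁ Mstar → Prop)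
    (κ : MemberY d ℓ hd hL b₀ b₁ Mstar → Sizes) (α ρ N N' Cℓ K θ₀ B₀ δ₀ a₁ M₁ : ℝ)
    (hc : 0 < c35) (hα : 0 < α) (hα2 : α ≤ 1 / 2) (hN : 0 ≤ N) (hN' : 0 ≤ N') (hCℓ : 1 ≤ Cℓ) (hK : 0 ≤ K)
    (hθ₀ : 0 ≤ θ₀) (hB₀ : 0 < B₀) (hδ₀ : 0 < δ₀) (ha₁ : 0 < a₁) (hM₁ : 0 < M₁)
    (hst : ∀ x, StaticOK (𝔬 x) ρ N N' Cℓ (κ x)) (hκ : ∀ x, (κ x).Bounded K θ₀ Cℓ (geo9Y x).M)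
    (hrd : ∀ x, (rd x).OK (𝔬 x).blk) (hloc : ∀ x, Locality (𝔬 x) (rd x))
    (h36 : ∀ x, M₁ ≤ (geo9Y x).M → ∀ α₀ : ℝ, 0 < α₀ → c35 * (geo9Y x).M * α₀ ≤ a₁ →
      ∀ U : (bg x).Cfg, (bg x).Reg335 c35 α₀ U →
        Local342 (𝔬 x) (R x) (H x) B₀ δ₀ U ∧ Identities (𝔬 x) (R x) (H x) U) :
    B9.Thm37Printed c35 geo9Y bg
        (fun x => W38OfOps (𝔬 x) (rd x) (R x) (H x)
          (const37 (exp261 (@geo9Y d ℓ hd hL b₀ b₁ Mstar) δ₀ α) δ₀ α ρ B₀ N N' Cℓ K) ((1 - 2 * α) * δ₀)) ∧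
      B9.Cor38Printed c35 geo9Y bg
        (fun x => W38OfOps (𝔬 x) (rd x) (R x) (H x)
          (const37 (exp261 (@geo9Y d ℓ hd hL b₀ b₁ Mstar) δ₀ α) δ₀ α ρ B₀ N N' Cℓ K) ((1 - 2 * α) * δ₀)) :=
  thm37_cor38_W38OfOps_exp261_of_rowSum261 𝔬 rd R H κ α ρ N N' Cℓ K θ₀ B₀ δ₀ a₁ M₁ hc hα hα2 hN hN' hCℓ hK hθ₀ hB₀
    hδ₀ ha₁ hM₁ hst hκ hrd hloc rowSum261_geo9Y h36

variable [∀ x, Fintype (A x)]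

/-- ★ **ROW 18 (t310) AT THE RECORD GEOMETRY WITH NO (2.61) BINDER**: Theorem 3.10 as the whole printed leaf at the literal datum
`W310OfOps (𝔬 x) (rd x) (Conv3107 (𝔬 x) (R x) (H x) (const37 (exp261 geo9Y δ₀ α) …) ((1 − 2α)δ₀))` over def-Y's members — (2.61)
from n06-i's `rowSum261_geo9Y` BY NAME. [cite: Balaban1985BackgroundPropagators, Thm 3.10 (3.107)–(3.108) pp.415–416 + (3.35) p.396; Balaban1984PropagatorsII, Lemma 2.1 (2.61) p.234] -/
theorem thm310Printed_exp261_geo9Y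
    (𝔬 : ∀ x : MemberY d ℓ hd hL b₀ b₁ Mstar, Ops310 (geo9Y x) (bg x) (X x) (Y x) (ι x) (A x))
    (rd : ∀ x : MemberY d ℓ hd hL b₀ b₁ Mstar, WalkReading310 (geo9Y x) (bg x) (X x) (ι x) (A x))
    (R : MemberY d ℓ hd hL b₀ b₁ Mstar → ℝ) (H : MemberY d ℓ hd hL b₀ b₁ Mstar → Prop)
    (κ : MemberY d ℓ hd hL b₀ b₁ Mstar → Sizes310) (α ρ N N' NF Cℓ K θ₀ B₀ δ₀ a₁ M₁ : ℝ)
    (hc : 0 < c35) (hα : 0 < α) (hα2 : α ≤ 1 / 2) (hN : 0 ≤ N) (hN' : 0 ≤ N') (hNF : 0 ≤ NF) (hCℓ : 1 ≤ Cℓ)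
    (hK : 0 ≤ K) (hθ₀ : 0 ≤ θ₀) (hB₀ : 0 < B₀) (hδ₀ : 0 < δ₀) (ha₁ : 0 < a₁) (hM₁ : 0 < M₁)
    (hst : ∀ x, StaticOK310 (𝔬 x) ρ N N' NF Cℓ (κ x)) (hκ : ∀ x, (κ x).Bounded K)
    (hrd : ∀ x, (rd x).OK (𝔬 x).blk) (hloc : ∀ x, Locality310 (𝔬 x) (rd x))
    (h36 : ∀ x, M₁ ≤ (geo9Y x).M → ∀ α₀ : ℝ, 0 < α₀ → c35 * (geo9Y x).M * α₀ ≤ a₁ →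
      ∀ U : (bg x).Cfg, (bg x).Reg335 c35 α₀ U →
        Local342G (𝔬 x) (R x) (H x) B₀ δ₀ U ∧ B9Thm310Whole.Factors389 (𝔬 x) (R x) (H x) θ₀ δ₀ U ∧
          Identities310 (𝔬 x) (R x) (H x) U) :
    B9.Thm310Printed c35 geo9Y bg
      (fun x => W310OfOps (𝔬 x) (rd x)
        (Conv3107 (𝔬 x) (R x) (H x) (const37 (exp261 (@geo9Y d ℓ hd hL b₀ b₁ Mstar) δ₀ α) δ₀ α ρ B₀ N N' Cℓ K)
          ((1 - 2 * α) * δ₀))) :=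
  thm310Printed_exp261_of_rowSum261 𝔬 rd R H κ α ρ N N' NF Cℓ K θ₀ B₀ δ₀ a₁ M₁ hc hα hα2 hN hN' hNF hCℓ hK hθ₀ hB₀
    hδ₀ ha₁ hM₁ hst hκ hrd hloc rowSum261_geo9Y h36

end FacesY

end Literature.MathematicalPhysics.QuantumFieldTheory.Balaban1983to89.B9RWSums347DefiniteFaces

end
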